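import Literature.NumberTheory.Irrationality.LaiLupuSprang2025.LinearForms
import Literature.NumberTheory.Transcendental.TaylorSeriesPadic
import Mathlib.RingTheory.PowerSeries.Derivative
import HarnessLib

/-!
# Lai–Lupu–Sprang 2025, §6 (tools): formal expansions `(w + qX)^{−a}`, `log(1 + qX/w)` in `ℚ⟦X⟧`, their `p`-adic
# evaluation on `ℤ_p`, scaled coefficient orders `ℤ_p⟦pX⟧`, and the ultrametric bookkeeping of §6 — PROVED

Topic `Literature/NumberTheory/Irrationality/LaiLupuSprang2025`.  Source: L. Lai, C. Lupu, J. Sprang, *On the irrationality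
of certain `p`-adic zeta values*, Res. Math. Sci. 12 (2025) = arXiv:2505.23088 [LaiLupuSprang2025], §2.2 (overconvergent
functions, the Bernoulli functional `𝓛_1(f) = Σ_k a_k B_{k+1}/(k+1)`, Lemma 2.4) and §6 (Lemma 6.1: «`Q(t) ∈ ℤ_p⟦pt⟧` …
`v_p(u_k) ≥ … + max{0, k−n}` … `v_p(𝓛_1(R_n(t+j/p))) ≥ … − max_k(… − v_p(k+1) − 1)`»; Lemma 6.2: «`Q(t) ∈ ℤ_p⟦p·t^{−1}⟧` …
the unique term of minimal valuation») (held text `paper:arxiv-2505.23088`, chunks p0004, p0009–p0010, read on the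
page).  PROOF FILE (definitions with bodies + theorems; no named fact, net debt 0): the generic lemmas behind the fifth and
sixth files of the discharge of `PAdicZetaValues.laiLupuSprang2025_theorem11`, on the tree's `Transcendental.pTaylor` /
`invLin` / `PSOrdGe` calculus (`TaylorSeriesPadic.lean`) and `LocalFields.volkenbornIntegral_powerSeries`.

## What is formalised (all PROVED)

* `coeff_invLin_pow`: `[X^m](invLin q w)^{a+1} = (−q)^m C(m+a,a) w^{−(m+a+1)}`; `logSer q w = Σ_{m≥1} q(−q)^{m−1}X^m/(m w^m)`
  (the series of `log(1 + qX/w)`) with `derivative_logSer` (`= q·invLin q w`) and `derivative_invLin_pow`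
  (`((invLin)^{a+1})′ = −q(a+1)(invLin)^{a+2}`).
* `hasSum_invLin_pow`, `hasSum_logSer`: **evaluation in `ℚ_p`** — for `‖qz/w‖_p < 1`,
  `Σ_m z^m [X^m](invLin q w)^{a+1} = (w + qz)^{−(a+1)}` and `Σ_m z^m [X^m]logSer = log_p(1 + qz/w)` (the «overconvergent» series
  of §2.2 evaluated on `ℤ_p`).
* `PSOrdGeS p v F` («`F ∈ p^v ℤ_p⟦pX⟧`»: `v_p([X^j]F) ≥ v + j`) with `mul/prod/pow`, the factors `C w + C p X`, `invLin p w`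
  (`p ∤ w`), and `padicOrdGe_coeff_mul_of_degree_le` (**`v_p([X^j](P·Q)) ≥ v + w + (j − n)`** for `P` of degree `≤ n` —
  the «`max{0, k − n}`» of Lemma 6.1).
* `norm_ratCast_le_of_padicOrdGe` (orders to norms in `ℚ_p`), `norm_tsum_bernoulli_smul_le`
  (`‖Σ_m B_m a_m‖_p ≤ p·sup‖a_m‖`, von Staudt–Clausen as `‖B_m‖_p ≤ p`), `norm_tsum_eq_of_dominant` (a unique term of
  minimal valuation decides the valuation of a convergent sum), `pow_padicValNat_le_mul_pow` (`p^{v_p(m)} ≤ (n+1)p^{m−1−n}`,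
  i.e. «`max{0,k−n} − v_p(k+1)`» is bounded), `padicValNat_lt_of_lt` (`v_p(m) < N + (m − p^N(p−1))` for `m > p^N(p−1)`, `N ≥ 1`),
  `norm_sum_zpow_neg_eq_one` (`‖Σ_{j<p} j^{−p^N(p−1)}‖_p = 1`, Fermat).
* §7, the congruence (eq:congP) of Lemma 6.2: `∏_{ν=1}^{p−1}(1 + νX) ≡ 1 − X^{p−1} (mod p)` (`prod_one_add_mul_X_zmod` in
  `(ℤ/p)[X]` from `X^{p−1} − 1 = ∏_{a≠0}(X − a)`, then `psOrdGe_prod_one_add_mul_X_sub` in `ℚ⟦X⟧`), and `psOrdGeS_invLin_one`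
  (`(1 + qX)^{−1} ∈ ℤ_p⟦pX⟧` for `p ∣ q`).

Cell zeta5-irr / pub-zeta5 (HONEST FRAMING: systematic search; no irrationality claim unless kernel-certified): formal
power-series plumbing for a PUBLISHED `p`-adic proof; nothing here bears on `ζ(5) ∈ ℝ`.
-/

noncomputable section

open Finset Filter Topology PowerSeries
open Literature.NumberTheory.Transcendental
open Literature.NumberTheory.LocalFields

namespace Literature.NumberTheory.Irrationality.LaiLupuSprang2025

/-! ## §1. Powers of `invLin` and the logarithmic series in `ℚ⟦X⟧` -/

/-- **`[X^m](invLin q w)^{a+1} = (−q)^m · C(m+a, a) · w^{−(m+a+1)}`** (`(w + qX)^{−(a+1)}` expanded; hockey-stick induction).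
[cite: LaiLupuSprang2025, §6 (6.4) ("Q(t) ∈ ℤ_p⟦pt⟧": the factors (pt + pm + j)^{−(p−1+s)})] -/
theorem coeff_invLin_pow (q w : ℚ) (a m : ℕ) :
    coeff m (invLin q w ^ (a + 1)) = (-q) ^ m * ((m + a).choose a : ℚ) / w ^ (m + a + 1) := by
  induction a generalizing m with
  | zero =>
    rw [zero_add, pow_one, coeff_invLin]
    simp
  | succ a ih =>
    rw [pow_succ, coeff_mul, Finset.Nat.sum_antidiagonal_eq_sum_range_succ_mk]
    simp only [ih, coeff_invLin]
    by_cases hw : w = 0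
    · subst hw
      simp
    have hterm : ∀ i ∈ range (m + 1), (-q) ^ i * (((i + a).choose a : ℕ) : ℚ) / w ^ (i + a + 1) *
        ((-q) ^ (m - i) / w ^ (m - i + 1)) = (-q) ^ m / w ^ (m + (a + 1) + 1) * (((i + a).choose a : ℕ) : ℚ) := by
      intro i hi
      have him : i ≤ m := Nat.lt_succ_iff.1 (mem_range.1 hi)
      have e1 : (-q) ^ i * (-q) ^ (m - i) = (-q) ^ m := by rw [← pow_add]; congr 1; omega
      have e2 : w ^ (i + a + 1) * w ^ (m - i + 1) = w ^ (m + (a + 1) + 1) := by rw [← pow_add]; congr 1; omega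
      field_simp
      rw [← e1, ← e2]
      ring
    rw [sum_congr rfl hterm, ← mul_sum, ← Nat.cast_sum]
    have hhs : ∑ i ∈ range (m + 1), (i + a).choose a = (m + (a + 1)).choose (a + 1) := by
      rw [Nat.sum_range_add_choose m a]; congr 1
    rw [hhs]
    ring

/-- **`((invLin q w)^{a+1})′ = −q(a+1)·(invLin q w)^{a+2}`** (the derivative of `(w+qX)^{−(a+1)}`), coefficientwise from
`coeff_invLin_pow` and `(m+1)C(m+a+1,a) = (a+1)C(m+a+1,a+1)`. [cite: LaiLupuSprang2025, §3 (3.3) ("the derivative of R̃_n(t) coincides with R_n(t)", termwise)] -/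
theorem derivative_invLin_pow (q w : ℚ) (a : ℕ) :
    d⁄dX ℚ (invLin q w ^ (a + 1)) = -C (q * (a + 1 : ℚ)) * invLin q w ^ (a + 2) := by
  ext m
  rw [coeff_derivative, coeff_invLin_pow, show a + 2 = (a + 1) + 1 by ring, neg_mul, map_neg, coeff_C_mul,
    coeff_invLin_pow, show m + 1 + a = m + a + 1 by ring, show m + (a + 1) = m + a + 1 by ring]
  -- `C(m+a+1, a+1) * (a+1) = C(m+a+1, a) * (m+1)`
  have hchoose : ((m + a + 1).choose a : ℚ) * ((m : ℚ) + 1) = ((a : ℚ) + 1) * ((m + a + 1).choose (a + 1) : ℚ) := by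
    have h := Nat.choose_succ_right_eq (m + a + 1) a
    rw [show m + a + 1 - a = m + 1 by omega] at h
    have h' : ((m + a + 1).choose (a + 1) : ℚ) * ((a : ℚ) + 1) = ((m + a + 1).choose a : ℚ) * ((m : ℚ) + 1) := by
      exact_mod_cast h
    linarith [h']
  have e : (-q) ^ (m + 1) * (((m + a + 1).choose a : ℕ) : ℚ) / w ^ (m + a + 1 + 1) * ((m : ℚ) + 1) =
      (-q) ^ m * (-q) * ((((m + a + 1).choose a : ℕ) : ℚ) * ((m : ℚ) + 1)) / w ^ (m + a + 1 + 1) := by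
    rw [pow_succ]; ring
  rw [e, hchoose]
  ring

/-- The formal logarithmic series of `log(1 + qX/w)`: `Σ_{m≥1} (−1)^{m−1} q^m X^m/(m w^m) = Σ_{m≥1} q(−q)^{m−1}X^m/(m w^m)`.
[cite: LaiLupuSprang2025, §3 (3.3) (the terms r_{1,k} log_p⟨t+k⟩ of the primitive R̃_n)] -/
def logSer (q w : ℚ) : ℚ⟦X⟧ :=
  PowerSeries.mk fun m => if m = 0 then 0 else q * (-q) ^ (m - 1) / ((w ^ m) * m)

/-- Coefficients of `logSer` in positive degree. [cite: LaiLupuSprang2025, §3 (3.3)] -/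
@[simp] theorem coeff_logSer_succ (q w : ℚ) (m : ℕ) :
    coeff (m + 1) (logSer q w) = q * (-q) ^ m / (w ^ (m + 1) * ((m : ℚ) + 1)) := by
  rw [logSer, coeff_mk, if_neg (Nat.succ_ne_zero m), Nat.add_sub_cancel]
  push_cast
  ring

/-- `logSer` has no constant term (`log 1 = 0`). [cite: LaiLupuSprang2025, §3 (3.3)] -/
@[simp] theorem coeff_logSer_zero (q w : ℚ) : coeff 0 (logSer q w) = 0 := by
  rw [logSer, coeff_mk, if_pos rfl]

/-- `constantCoeff (logSer q w) = 0`. [cite: LaiLupuSprang2025, §3 (3.3)] -/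
@[simp] theorem constantCoeff_logSer (q w : ℚ) : constantCoeff (logSer q w) = 0 := by
  rw [← coeff_zero_eq_constantCoeff_apply, coeff_logSer_zero]

/-- **`(logSer q w)′ = q · invLin q w`** (`d/dX log(1 + qX/w) = q/(w + qX)`). [cite: LaiLupuSprang2025, §3 (3.3) and Lemma 4.3 (4.6) (the derivative 1/(ν + j/p))] -/
theorem derivative_logSer (q w : ℚ) : d⁄dX ℚ (logSer q w) = C q * invLin q w := by
  ext m
  rw [coeff_derivative, coeff_logSer_succ, coeff_C_mul, coeff_invLin]
  by_cases hw : w = 0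
  · subst hw; simp
  have hm : ((m : ℚ) + 1) ≠ 0 := by positivity
  field_simp

/-! ## §2. Scaled coefficient orders: `F ∈ p^v ℤ_p⟦pX⟧` -/

/-- `PSOrdGeS p v F`: the coefficient of `X^j` in `F` has `p`-adic order `≥ v + j` («`F ∈ p^v·ℤ_p⟦pX⟧`»).
[cite: LaiLupuSprang2025, Lemma 6.1 (6.4) ("Q(t) ∈ ℤ_p⟦pt⟧") and Lemma 6.2 ("Q(t) ∈ ℤ_p⟦p·t^{−1}⟧")] -/
def PSOrdGeS (p : ℕ) (v : ℤ) (F : ℚ⟦X⟧) : Prop :=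
  ∀ j : ℕ, PadicOrdGe p (v + j) (coeff j F)

namespace PSOrdGeS

variable {p : ℕ} {v w : ℤ} {F G : ℚ⟦X⟧}

/-- Coefficient access. [cite: LaiLupuSprang2025, Lemma 6.1 (6.4)] -/
theorem coeff (h : PSOrdGeS p v F) (j : ℕ) : PadicOrdGe p (v + j) (PowerSeries.coeff j F) := h j

/-- Forgetting the scaling: `PSOrdGeS p v F → PSOrdGe p v F`. [cite: LaiLupuSprang2025, Lemma 6.1 (6.4)] -/
theorem psOrdGe (h : PSOrdGeS p v F) : PSOrdGe p v F := fun j => (h j).mono (by omega)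

/-- `1 ∈ ℤ_p⟦pX⟧`. [cite: LaiLupuSprang2025, Lemma 6.1 (6.4)] -/
theorem one (p : ℕ) : PSOrdGeS p 0 (1 : ℚ⟦X⟧) := fun j => by
  rw [coeff_one]
  split_ifs with h
  · subst h; simpa using PadicOrdGe.of_int (p := p) 1
  · exact PadicOrdGe.zero _

/-- Constants: `C c ∈ p^v ℤ_p⟦pX⟧` if `v_p(c) ≥ v`. [cite: LaiLupuSprang2025, Lemma 6.1 (6.4)] -/
theorem C {c : ℚ} (hc : PadicOrdGe p v c) : PSOrdGeS p v (PowerSeries.C c) := fun j => by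
  rw [coeff_C]
  split_ifs with h
  · subst h; simpa using hc
  · exact PadicOrdGe.zero _

/-- Products: orders add. [cite: LaiLupuSprang2025, Lemma 6.1 (6.4) ("belong to ℤ_p⟦pt⟧", closed under products)] -/
theorem mul [Fact p.Prime] (hF : PSOrdGeS p v F) (hG : PSOrdGeS p w G) : PSOrdGeS p (v + w) (F * G) := fun j => by
  rw [coeff_mul]
  refine PadicOrdGe.sum fun ij hij => ?_
  have hsum : ij.1 + ij.2 = j := Finset.HasAntidiagonal.mem_antidiagonal.1 hij
  have h := (hF ij.1).mul (hG ij.2)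
  exact h.mono (by omega)

/-- Powers (order `0`). [cite: LaiLupuSprang2025, Lemma 6.1 (6.4)] -/
theorem pow [Fact p.Prime] (hF : PSOrdGeS p 0 F) (n : ℕ) : PSOrdGeS p 0 (F ^ n) := by
  induction n with
  | zero => rw [pow_zero]; exact one p
  | succ n ih => rw [pow_succ]; simpa using ih.mul hF

/-- Finite products (order `0`). [cite: LaiLupuSprang2025, Lemma 6.1 (6.4)] -/
theorem prod [Fact p.Prime] {ι : Type*} (s : Finset ι) {Φ : ι → ℚ⟦X⟧} (h : ∀ i ∈ s, PSOrdGeS p 0 (Φ i)) :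
    PSOrdGeS p 0 (∏ i ∈ s, Φ i) := by
  classical
  induction s using Finset.induction_on with
  | empty => rw [prod_empty]; exact one p
  | insert a s ha ih =>
    rw [prod_insert ha]
    simpa using (h a (mem_insert_self a s)).mul (ih fun i hi => h i (mem_insert_of_mem hi))

/-- Scaling by a constant of order `≥ v`. [cite: LaiLupuSprang2025, Lemma 6.1 (6.4)] -/
theorem C_mul [Fact p.Prime] {c : ℚ} (hc : PadicOrdGe p v c) (hF : PSOrdGeS p w F) :
    PSOrdGeS p (v + w) (PowerSeries.C c * F) := (C hc).mul hF

end PSOrdGeS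

/-- The linear factor `C w + C p·X ∈ ℤ_p⟦pX⟧` for `p`-integral `w`. [cite: LaiLupuSprang2025, Lemma 6.1 (6.2)–(6.3) (the factors pt + j, pt + pm + j + ν)] -/
theorem psOrdGeS_lin {p : ℕ} [Fact p.Prime] {w : ℚ} (hw : PadicOrdGe p 0 w) :
    PSOrdGeS p 0 (C w + C (p : ℚ) * X) := fun j => by
  rw [map_add, coeff_C, coeff_C_mul, coeff_X]
  rcases j with _ | _ | j
  · simpa using hw
  · simp only [zero_add, Nat.cast_one]
    simpa using padicOrdGe_one_natCast p
  · simp only [add_assoc]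
    norm_num
    exact PadicOrdGe.zero _

/-- The inverse factor `invLin p w = (w + pX)^{−1} ∈ ℤ_p⟦pX⟧` for a `p`-adic unit `w` (`v_p(w⁻¹) ≥ 0`).
[cite: LaiLupuSprang2025, Lemma 6.1 (6.3)–(6.4) (the factors (pt + pm + j)^{−(p−1+s)} "belong to ℤ_p⟦pt⟧")] -/
theorem psOrdGeS_invLin {p : ℕ} [Fact p.Prime] {w : ℚ} (hw : PadicOrdGe p 0 w⁻¹) :
    PSOrdGeS p 0 (invLin (p : ℚ) w) := fun j => by
  rw [coeff_invLin, zero_add, neg_pow, show ((-1 : ℚ) ^ j * (p : ℚ) ^ j) / w ^ (j + 1) =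
    (-1 : ℚ) ^ j * ((p : ℚ) ^ j * (w⁻¹) ^ (j + 1)) by rw [inv_pow]; field_simp]
  have h1 : PadicOrdGe p 0 ((-1 : ℚ) ^ j) := by
    have := (PadicOrdGe.of_int (p := p) (-1)).pow j
    simpa using this
  have h2 : PadicOrdGe p j ((p : ℚ) ^ j) := by
    have := (padicOrdGe_one_natCast p).pow j
    simpa using this
  have h3 : PadicOrdGe p 0 ((w⁻¹) ^ (j + 1)) := by simpa using hw.pow (j + 1)
  simpa using h1.mul (h2.mul h3)

/-- The inverse factor at infinity `invLin q 1 = (1 + qX)^{−1} = Σ (−q)^j X^j ∈ ℤ_p⟦pX⟧` when `p ∣ q` (`v_p(q) ≥ 1`; used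
with `q = pk`). [cite: LaiLupuSprang2025, Lemma 6.2 (the factors (1 + pkt)^{−i}, "h(t) ∈ 1 + tℤ_p⟦t⟧")] -/
theorem psOrdGeS_invLin_one {p : ℕ} [Fact p.Prime] {q : ℚ} (hq : PadicOrdGe p 1 q) :
    PSOrdGeS p 0 (invLin q 1) := fun j => by
  rw [coeff_invLin, zero_add, one_pow, div_one, neg_pow]
  have h1 : PadicOrdGe p 0 ((-1 : ℚ) ^ j) := by
    have := (PadicOrdGe.of_int (p := p) (-1)).pow j
    simpa using this
  have h2 : PadicOrdGe p j (q ^ j) := by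
    have := hq.pow j
    simpa using this
  simpa using h1.mul h2

/-- **The `max{0, k − n}` gain**: if `P` has `p`-integral coefficients (order `≥ v`) and degree `≤ n`, and
`Q ∈ p^w ℤ_p⟦pX⟧`, then `v_p([X^j](P·Q)) ≥ v + w + (j − n)`. [cite: LaiLupuSprang2025, Lemma 6.1 ("Noting that deg P = n, we deduce … v_p(u_k) ≥ … + max{0, k−n}")] -/
theorem padicOrdGe_coeff_mul_of_degree_le {p : ℕ} [Fact p.Prime] {v w : ℤ} {P Q : ℚ⟦X⟧} {n : ℕ}
    (hP : PSOrdGe p v P) (hdeg : ∀ j, n < j → coeff j P = 0) (hQ : PSOrdGeS p w Q) (j : ℕ) :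
    PadicOrdGe p (v + w + ((j : ℤ) - n)) (coeff j (P * Q)) := by
  rw [coeff_mul]
  refine PadicOrdGe.sum fun ij hij => ?_
  have hsum : ij.1 + ij.2 = j := Finset.HasAntidiagonal.mem_antidiagonal.1 hij
  by_cases h : n < ij.1
  · rw [hdeg _ h, zero_mul]; exact PadicOrdGe.zero _
  · have := (hP ij.1).mul (hQ ij.2)
    exact this.mono (by push Not at h; omega)

/-! ## §3. From orders in `ℚ` to norms in `ℚ_p` -/

section Padic

variable {p : ℕ} [hp : Fact p.Prime]

/-- `‖q‖_p = p^{−v_p(q)}` for a nonzero rational `q`. [cite: LaiLupuSprang2025, §6 ("we bound the p-adic norm", |·|_p = p^{−v_p(·)})] -/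
private theorem norm_ratCast_eq_zpow {q : ℚ} (hq : q ≠ 0) : ‖(q : ℚ_[p])‖ = (p : ℝ) ^ (-padicValRat p q) := by
  rw [Padic.eq_padicNorm, padicNorm.eq_zpow_of_nonzero hq]
  push_cast
  rfl

/-- **Orders to norms**: `v_p(q) ≥ v ⇒ ‖q‖_p ≤ p^{−v}`. [cite: LaiLupuSprang2025, §6 (|·|_p = p^{−v_p(·)})] -/
theorem norm_ratCast_le_of_padicOrdGe {v : ℤ} {q : ℚ} (h : PadicOrdGe p v q) : ‖(q : ℚ_[p])‖ ≤ (p : ℝ) ^ (-v) := by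
  rcases h with h0 | hv
  · subst h0; simp; positivity
  · by_cases hq : q = 0
    · subst hq; simp; positivity
    rw [norm_ratCast_eq_zpow hq]
    exact zpow_le_zpow_right₀ (by exact_mod_cast hp.out.one_lt.le) (by omega)

/-- `‖z‖_p = 1` for an integer `z` prime to `p`. [cite: LaiLupuSprang2025, Lemma 6.2 (eq:cong_hk2) ("h ≡ 1 mod p": units)] -/
private theorem norm_intCast_eq_one_of_not_dvd {z : ℤ} (hz : ¬ (p : ℤ) ∣ z) : ‖(z : ℚ_[p])‖ = 1 := by
  have h1 : ‖(z : ℚ_[p])‖ ≤ 1 := Padic.norm_int_le_one z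
  have h2 : ¬ ‖(z : ℚ_[p])‖ < 1 := fun h => hz (Padic.norm_intCast_lt_one_iff.1 h)
  push Not at h2
  exact le_antisymm h1 h2

/-! ## §4. Evaluation of the formal expansions on `ℤ_p` -/

/-- **`Σ_m z^m·[X^m](invLin q w)^{a+1} = (w + qz)^{−(a+1)}` in `ℚ_p`** for `‖qz/w‖_p < 1` (the binomial series; the tree's
`hasSum_choose_mul_geometric_of_norm_lt_one`). [cite: LaiLupuSprang2025, §2.2 ("f(x) = Σ a_k x^k with |a_k|_p ρ^k → 0": evaluation of overconvergent series) and Lemma 6.1 (6.5)] -/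
theorem hasSum_invLin_pow {q w : ℚ} (hw : w ≠ 0) {z : ℚ_[p]} (hz : ‖(q : ℚ_[p]) * z / w‖ < 1) (a : ℕ) :
    HasSum (fun m : ℕ => z ^ m * ((coeff m (invLin q w ^ (a + 1)) : ℚ) : ℚ_[p]))
      ((((w : ℚ_[p]) + q * z) ^ (a + 1))⁻¹) := by
  have hw' : (w : ℚ_[p]) ≠ 0 := by exact_mod_cast hw
  set r : ℚ_[p] := -((q : ℚ_[p]) * z / w) with hr
  have hrn : ‖r‖ < 1 := by rw [hr, norm_neg]; exact hz
  have h := (hasSum_choose_mul_geometric_of_norm_lt_one a hrn).mul_left (((w : ℚ_[p]) ^ (a + 1))⁻¹)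
  have hval : ((w : ℚ_[p]) ^ (a + 1))⁻¹ * (1 / (1 - r) ^ (a + 1)) = (((w : ℚ_[p]) + q * z) ^ (a + 1))⁻¹ := by
    rw [one_div, ← mul_inv, ← mul_pow]
    congr 2
    rw [hr]
    field_simp
    ring
  rw [hval] at h
  refine h.congr_fun fun m => ?_
  simp only [hr, coeff_invLin_pow]
  push_cast
  rw [neg_pow, neg_pow ((q : ℚ_[p]) * z / w), div_pow, mul_pow]
  field_simp
  ring

/-- **`Σ_m z^m·[X^m]logSer q w = log_p(1 + qz/w)` in `ℚ_p`** for `‖qz/w‖_p < 1` (the logarithmic series of the tree's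
`PadicExp.plog`). [cite: LaiLupuSprang2025, §2.3 ("log_p … extended", the series of log_p on 1 + pℤ_p) and Lemma 4.3 (4.5)] -/
theorem hasSum_logSer {q w : ℚ} (hw : w ≠ 0) {z : ℚ_[p]} (hz : ‖(q : ℚ_[p]) * z / w‖ < 1) :
    HasSum (fun m : ℕ => z ^ m * ((coeff m (logSer q w) : ℚ) : ℚ_[p]))
      (Transcendental.PadicExp.plog (1 + (q : ℚ_[p]) * z / w)) := by
  have hw' : (w : ℚ_[p]) ≠ 0 := by exact_mod_cast hw
  have hy : ‖(1 : ℚ_[p]) - (1 + (q : ℚ_[p]) * z / w)‖ < 1 := by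
    rw [show (1 : ℚ_[p]) - (1 + (q : ℚ_[p]) * z / w) = -((q : ℚ_[p]) * z / w) by ring, norm_neg]; exact hz
  have h := Transcendental.PadicExp.hasSum_plog (ℓ := p) hy
  have hfun : ∀ m : ℕ, -((1 - (1 + (q : ℚ_[p]) * z / w)) ^ (m + 1)) / ((m : ℚ_[p]) + 1) =
      z ^ (m + 1) * ((coeff (m + 1) (logSer q w) : ℚ) : ℚ_[p]) := by
    intro m
    rw [coeff_logSer_succ, show (1 : ℚ_[p]) - (1 + (q : ℚ_[p]) * z / w) = -((q : ℚ_[p]) * z / w) by ring, neg_pow,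
      div_pow, mul_pow]
    push_cast
    have hm : ((m : ℚ_[p]) + 1) ≠ 0 := by exact_mod_cast (Nat.cast_add_one_ne_zero m : ((m : ℚ) + 1) ≠ 0)
    field_simp
    ring
  simp_rw [hfun] at h
  refine (hasSum_nat_add_iff' 1).1 ?_
  simpa using h

/-! ## §5. Ultrametric bookkeeping -/

/-- **`‖Σ_m B_m·a_m‖_p ≤ p·B`** when `‖a_m‖_p ≤ B` for all `m` (von Staudt–Clausen as `‖B_m‖_p ≤ p`): the size of the
value `𝓛_1`/Volkenborn integral of a restricted power series. [cite: LaiLupuSprang2025, Lemma 6.1 (last display: "v_p(Σ u_k B_{k+1}/(k+1)) ≥ … − v_p(k+1) − 1")] -/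
theorem norm_tsum_bernoulli_smul_le {a : ℕ → ℚ_[p]} {B : ℝ} (hB0 : 0 ≤ B)
    (hB : ∀ m, ‖a m‖ ≤ B) :
    ‖∑' m : ℕ, (((bernoulli m : ℚ) : ℚ_[p])) • a m‖ ≤ p * B := by
  refine IsUltrametricDist.norm_tsum_le_of_forall_le_of_nonneg (by positivity) fun m => ?_
  rw [norm_smul]
  exact mul_le_mul (norm_bernoulli_le m) (hB m) (norm_nonneg _) (by positivity)

/-- **A unique dominant term decides the norm**: if `Σ f` converges, `‖f m₀‖ > c ≥ ‖f m‖` for all `m ≠ m₀`, then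
`‖Σ_m f m‖ = ‖f m₀‖`. [cite: LaiLupuSprang2025, Lemma 6.2 ("we have equality if and only if k = (p−1)p^N + 1 … This shows v_p(Σ …) = m")] -/
theorem norm_tsum_eq_of_dominant {f : ℕ → ℚ_[p]} (hf : Summable f) (m₀ : ℕ) {c : ℝ} (hc0 : 0 ≤ c)
    (hc : c < ‖f m₀‖) (h : ∀ m, m ≠ m₀ → ‖f m‖ ≤ c) : ‖∑' m, f m‖ = ‖f m₀‖ := by
  classical
  rw [hf.tsum_eq_add_tsum_ite m₀]
  have hrest : ‖∑' m, (if m = m₀ then 0 else f m)‖ ≤ c := by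
    refine IsUltrametricDist.norm_tsum_le_of_forall_le_of_nonneg hc0 fun m => ?_
    split_ifs with hm
    · rw [norm_zero]; exact hc0
    · exact h m hm
  have hne : ‖f m₀‖ ≠ ‖∑' m, (if m = m₀ then 0 else f m)‖ := ne_of_gt (hrest.trans_lt hc)
  rw [Padic.add_eq_max_of_ne hne, max_eq_left (hrest.trans hc.le)]

/-- A finite sum of terms of norm `< 1` has norm `< 1`. [cite: LaiLupuSprang2025, Lemma 6.2 (last display, "≡ … mod p^{m+1}")] -/
theorem norm_sum_lt_one {ι : Type*} (s : Finset ι) {f : ι → ℚ_[p]} (h : ∀ i ∈ s, ‖f i‖ < 1) :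
    ‖∑ i ∈ s, f i‖ < 1 := by
  classical
  induction s using Finset.induction_on with
  | empty => simp
  | insert a s ha ih =>
    rw [sum_insert ha]
    refine (Padic.nonarchimedean _ _).trans_lt (max_lt (h a (mem_insert_self a s)) ?_)
    exact ih fun i hi => h i (mem_insert_of_mem hi)

/-! ## §6. Arithmetic lemmas for §6 -/

/-- **`p^{v_p(m)} ≤ (n+1)·p^{m−1−n}`** (`m ≥ 1`; truncated subtraction): the loss `v_p(k+1)` against the gain `max{0,k−n}` in
Lemma 6.1 is at most `log_p(n+1)`. [cite: LaiLupuSprang2025, Lemma 6.1 (last display: "max_k(… max{0,k−n} − v_p(k+1) − 1)")] -/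
theorem pow_padicValNat_le_mul_pow {m : ℕ} (hm : m ≠ 0) (n : ℕ) : p ^ padicValNat p m ≤ (n + 1) * p ^ (m - 1 - n) := by
  have h1 : p ^ padicValNat p m ≤ m := Nat.le_of_dvd (Nat.pos_of_ne_zero hm) pow_padicValNat_dvd
  refine h1.trans ?_
  by_cases hmn : m ≤ n + 1
  · have : m - 1 - n = 0 := by omega
    rw [this, pow_zero, mul_one]; exact hmn
  · set d := m - 1 - n with hd
    have hm' : m = n + 1 + d := by omega
    have hpd : d + 1 ≤ p ^ d := by
      have := Nat.lt_pow_self hp.out.one_lt (n := d)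
      omega
    rw [hm']
    nlinarith

/-- **`v_p(m) < N + (m − p^N(p−1))` for `m > p^N(p−1)`** (the terms beyond the dominant index in Lemma 6.2:
«for `k > p^N(p−1)+1` … `v_p(h_k/(1−k)) ≥ 0`», here in the weaker form that suffices). [cite: LaiLupuSprang2025, Lemma 6.2 ("For k > (n+1)(s+p−1) − M_0 = p^N(p−1)+1, we have … ≥ 0")] -/
theorem padicValNat_lt_of_lt {N m : ℕ} (hN : 1 ≤ N) (hm : p ^ N * (p - 1) < m) :
    padicValNat p m < N + (m - p ^ N * (p - 1)) := by
  have hm0 : m ≠ 0 := by omega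
  set e := padicValNat p m with he
  by_cases heN : e ≤ N
  · omega
  · push Not at heN
    have hdvd : p ^ e ∣ m := pow_padicValNat_dvd
    have hle : p ^ e ≤ m := Nat.le_of_dvd (Nat.pos_of_ne_zero hm0) hdvd
    have hpN : p ^ N * (p - 1) + p ^ N = p ^ (N + 1) := by
      rw [pow_succ]; zify [hp.out.one_lt.le]; ring
    have hpNge : N + 1 ≤ p ^ N := by
      have := Nat.lt_pow_self hp.out.one_lt (n := N); omega
    -- write `e = N + 1 + d`; then `p^e ≥ p^{N+1}(d+1) ≥ p^{N+1} + d`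
    obtain ⟨d, hd⟩ : ∃ d, e = N + 1 + d := ⟨e - (N + 1), by omega⟩
    have hpd : d + 1 ≤ p ^ d := by
      have := Nat.lt_pow_self hp.out.one_lt (n := d); omega
    have hpe : p ^ (N + 1) * (d + 1) ≤ p ^ e := by
      rw [hd, pow_add p (N + 1) d]; exact Nat.mul_le_mul_left _ hpd
    have hone : 1 ≤ p ^ (N + 1) := Nat.one_le_pow _ _ hp.out.pos
    have hpe' : p ^ (N + 1) + d ≤ p ^ e := by nlinarith
    omega

/-- **`‖Σ_{j=1}^{p−1} j^{−p^N(p−1)}‖_p = 1`** (Fermat: `j^{p^N(p−1)} ≡ 1 (mod p)`, so the sum is `≡ p − 1 ≢ 0`).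
[cite: LaiLupuSprang2025, Lemma 6.2 (last display: "Σ_{j=1}^{p−1} h j^{−p^N(p−1)} ≡ … Σ_{j=1}^{p−1} 1")] -/
theorem norm_sum_zpow_neg_eq_one (N : ℕ) :
    ‖∑ j ∈ Ico 1 p, ((j : ℚ_[p]) ^ (p ^ N * (p - 1)))⁻¹‖ = 1 := by
  have hp1 : 2 ≤ p := hp.out.two_le
  -- each term is `1 +` something of norm `< 1`
  have hterm : ∀ j ∈ Ico 1 p, ‖((j : ℚ_[p]) ^ (p ^ N * (p - 1)))⁻¹ - 1‖ < 1 := by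
    intro j hj
    have hj1 : 1 ≤ j := (mem_Ico.1 hj).1
    have hjp : j < p := (mem_Ico.1 hj).2
    have hnd : ¬ p ∣ j := fun h => by have := Nat.le_of_dvd (by omega) h; omega
    have hnorm : ‖(j : ℚ_[p])‖ = 1 := by
      have := norm_intCast_eq_one_of_not_dvd (p := p) (z := j) (by exact_mod_cast hnd)
      simpa using this
    -- Fermat: `p ∣ j^{p−1} − 1`, hence `p ∣ j^{p^N(p−1)} − 1`
    have hF : (p : ℤ) ∣ (j : ℤ) ^ (p - 1) - 1 := by
      have h := ZMod.pow_card_sub_one_eq_one (p := p) (a := (j : ZMod p)) (by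
        rw [Ne, ZMod.natCast_eq_zero_iff]; exact hnd)
      have : (((j : ℤ) ^ (p - 1) - 1 : ℤ) : ZMod p) = 0 := by push_cast; rw [h, sub_self]
      exact (ZMod.intCast_zmod_eq_zero_iff_dvd _ p).1 this
    have hF' : (p : ℤ) ∣ (j : ℤ) ^ (p ^ N * (p - 1)) - 1 := by
      rw [mul_comm, pow_mul]
      exact hF.trans (by simpa using sub_dvd_pow_sub_pow ((j : ℤ) ^ (p - 1)) 1 (p ^ N))
    have hlt : ‖(((j : ℤ) ^ (p ^ N * (p - 1)) - 1 : ℤ) : ℚ_[p])‖ < 1 :=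
      Padic.norm_intCast_lt_one_iff.2 hF'
    push_cast at hlt
    have hpow : ‖(j : ℚ_[p]) ^ (p ^ N * (p - 1))‖ = 1 := by rw [norm_pow, hnorm, one_pow]
    have hne0 : (j : ℚ_[p]) ^ (p ^ N * (p - 1)) ≠ 0 := by
      rw [← norm_pos_iff, hpow]; exact one_pos
    have e : ((j : ℚ_[p]) ^ (p ^ N * (p - 1)))⁻¹ - 1 =
        -(((j : ℚ_[p]) ^ (p ^ N * (p - 1)) - 1) * ((j : ℚ_[p]) ^ (p ^ N * (p - 1)))⁻¹) := by
      rw [← neg_mul, neg_sub, sub_mul, one_mul, mul_inv_cancel₀ hne0]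
    rw [e, norm_neg, norm_mul, norm_inv, hpow, inv_one, mul_one]
    exact hlt
  have hsplit : ∑ j ∈ Ico 1 p, ((j : ℚ_[p]) ^ (p ^ N * (p - 1)))⁻¹ =
      (((p - 1 : ℕ) : ℤ) : ℚ_[p]) + ∑ j ∈ Ico 1 p, (((j : ℚ_[p]) ^ (p ^ N * (p - 1)))⁻¹ - 1) := by
    rw [sum_sub_distrib, sum_const, Nat.card_Ico]
    push_cast
    ring
  have hsmall := norm_sum_lt_one (Ico 1 p) hterm
  have hunit : ‖(((p - 1 : ℕ) : ℤ) : ℚ_[p])‖ = 1 := by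
    refine norm_intCast_eq_one_of_not_dvd ?_
    intro h
    have h' : (p : ℤ) ∣ ((p - 1 : ℕ) : ℤ) := h
    have h0 : 0 < p - 1 := by omega
    have := Int.le_of_dvd (by exact_mod_cast h0) h'
    push_cast [Nat.cast_sub hp.out.one_lt.le] at this
    omega
  rw [hsplit]
  have hne : ‖(((p - 1 : ℕ) : ℤ) : ℚ_[p])‖ ≠ ‖∑ j ∈ Ico 1 p, (((j : ℚ_[p]) ^ (p ^ N * (p - 1)))⁻¹ - 1)‖ := by
    rw [hunit]; exact ne_of_gt hsmall
  rw [Padic.add_eq_max_of_ne hne, hunit, max_eq_left hsmall.le]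

end Padic

/-! ## §7. `∏_{ν=1}^{p−1}(1 + νX) ≡ 1 − X^{p−1} (mod p)` — the congruence (eq:congP) -/

section CongP

open Polynomial in
/-- In `𝔽_p[X]`: `∏_{ν=1}^{p−1}(1 + νX) = 1 − X^{p−1}` (both vanish at every unit — Fermat, and at a unit `x` the factor
`ν = −x⁻¹` vanishes — agree at `0`, and have degree `< p`). [cite: LaiLupuSprang2025, Lemma 6.2 (eq:congP) ("P(t) ≡ (t^{p−1} − 1)^n mod pℤ_p[t]")] -/
theorem prod_one_add_mul_X_zmod (p : ℕ) [hp : Fact p.Prime] :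
    (∏ ν ∈ Ico 1 p, (1 + Polynomial.C ((ν : ℕ) : ZMod p) * Polynomial.X) : Polynomial (ZMod p)) =
      1 - Polynomial.X ^ (p - 1) := by
  have hp1 : 1 ≤ p := hp.out.one_lt.le
  set Q : Polynomial (ZMod p) := ∏ ν ∈ Ico 1 p, (1 + Polynomial.C ((ν : ℕ) : ZMod p) * Polynomial.X) with hQ
  refine Polynomial.eq_of_natDegree_lt_card_of_eval_eq Q (1 - Polynomial.X ^ (p - 1)) (f := fun x : ZMod p => x)
    (fun _ _ h => h) (fun x => ?_) ?_
  · -- evaluations agree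
    rw [hQ, Polynomial.eval_prod]
    simp only [Polynomial.eval_add, Polynomial.eval_one, Polynomial.eval_mul, Polynomial.eval_C, Polynomial.eval_X,
      Polynomial.eval_sub, Polynomial.eval_pow]
    by_cases hx : x = 0
    · subst hx
      have hp0 : p - 1 ≠ 0 := by have := hp.out.two_le; omega
      simp only [mul_zero, add_zero, prod_const_one, zero_pow hp0, sub_zero]
    · rw [ZMod.pow_card_sub_one_eq_one hx, sub_self]
      refine prod_eq_zero (i := ((-x⁻¹ : ZMod p).val)) ?_ ?_
      · rw [mem_Ico]
        refine ⟨Nat.one_le_iff_ne_zero.2 fun h => ?_, ZMod.val_lt _⟩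
        rw [ZMod.val_eq_zero, neg_eq_zero, _root_.inv_eq_zero] at h
        exact hx h
      · rw [ZMod.natCast_zmod_val, neg_mul, inv_mul_cancel₀ hx, add_neg_cancel]
  · -- degrees `< p = #𝔽_p`
    rw [ZMod.card]
    have hQdeg : Q.natDegree ≤ p - 1 := by
      rw [hQ]
      refine (Polynomial.natDegree_prod_le _ _).trans ?_
      have hterm : ∀ i ∈ Ico 1 p, (1 + Polynomial.C ((i : ℕ) : ZMod p) * Polynomial.X).natDegree ≤ 1 := by
        intro i _
        refine (Polynomial.natDegree_add_le _ _).trans (max_le (by simp) ?_)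
        exact (Polynomial.natDegree_C_mul_le _ _).trans Polynomial.natDegree_X_le
      refine (sum_le_sum (g := fun _ => 1) hterm).trans ?_
      simp
    have h2 : (1 - Polynomial.X ^ (p - 1) : Polynomial (ZMod p)).natDegree ≤ p - 1 := by
      refine (Polynomial.natDegree_sub_le _ _).trans (max_le (by simp) ?_)
      simp
    have := max_le hQdeg h2
    omega

/-- The integer polynomial `∏_{ν=1}^{p−1}(1 + νX) − (1 − X^{p−1})` has all coefficients divisible by `p`.
[cite: LaiLupuSprang2025, Lemma 6.2 (eq:congP)] -/
theorem dvd_coeff_prod_one_add_mul_X_sub (p : ℕ) [hp : Fact p.Prime] (j : ℕ) :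
    (p : ℤ) ∣ ((∏ ν ∈ Ico 1 p, (1 + Polynomial.C (ν : ℤ) * Polynomial.X) -
      (1 - Polynomial.X ^ (p - 1)) : Polynomial ℤ)).coeff j := by
  set P : Polynomial ℤ := (∏ ν ∈ Ico 1 p, (1 + Polynomial.C (ν : ℤ) * Polynomial.X) -
    (1 - Polynomial.X ^ (p - 1))) with hP
  rw [← ZMod.intCast_zmod_eq_zero_iff_dvd]
  have hcoe : ((P.coeff j : ℤ) : ZMod p) = (P.map (Int.castRingHom (ZMod p))).coeff j := by
    rw [Polynomial.coeff_map]; rfl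
  rw [hcoe]
  have hmap : P.map (Int.castRingHom (ZMod p)) = 0 := by
    rw [hP, Polynomial.map_sub, Polynomial.map_prod]
    simp only [Polynomial.map_add, Polynomial.map_one, Polynomial.map_mul, Polynomial.map_C, Polynomial.map_X,
      Polynomial.map_sub, Polynomial.map_pow]
    simp only [eq_intCast, Int.cast_natCast]
    rw [prod_one_add_mul_X_zmod p, sub_self]
  rw [hmap, Polynomial.coeff_zero]

/-- **(eq:congP) in `ℚ⟦X⟧`: `∏_{ν=1}^{p−1}(1 + νX) − (1 − X^{p−1})` has all coefficients of `p`-adic order `≥ 1`.**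
[cite: LaiLupuSprang2025, Lemma 6.2 (eq:congP) ("P(t) ≡ (t^{p−1} − 1)^n mod pℤ_p[t]")] -/
theorem psOrdGe_prod_one_add_mul_X_sub (p : ℕ) [hp : Fact p.Prime] :
    PSOrdGe p 1 ((∏ ν ∈ Ico 1 p, (1 + C (ν : ℚ) * X)) - (1 - X ^ (p - 1))) := by
  -- the power series is the image of the integer polynomial
  set P : Polynomial ℤ := (∏ ν ∈ Ico 1 p, (1 + Polynomial.C (ν : ℤ) * Polynomial.X) -
    (1 - Polynomial.X ^ (p - 1))) with hP
  set φ : Polynomial ℤ →+* ℚ⟦X⟧ :=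
    (Polynomial.coeToPowerSeries.ringHom (R := ℚ)).comp (Polynomial.mapRingHom (Int.castRingHom ℚ)) with hφ
  have hφC : ∀ z : ℤ, φ (Polynomial.C z) = C (z : ℚ) := fun z => by
    simp [hφ, Polynomial.coeToPowerSeries.ringHom]
  have hφX : φ Polynomial.X = X := by
    simp [hφ, Polynomial.coeToPowerSeries.ringHom, Polynomial.coe_X]
  have himage : φ P = (∏ ν ∈ Ico 1 p, (1 + C (ν : ℚ) * X)) - (1 - X ^ (p - 1)) := by
    rw [hP, map_sub, map_prod, map_sub, map_one, map_pow, hφX]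
    congr 1
    refine prod_congr rfl fun ν _ => ?_
    rw [map_add, map_one, map_mul, hφC, hφX]
    norm_cast
  have hcoeff : ∀ j, coeff j (φ P) = ((P.coeff j : ℤ) : ℚ) := fun j => by
    simp [hφ, Polynomial.coeToPowerSeries.ringHom, Polynomial.coeff_coe]
  rw [← himage]
  intro j
  rw [hcoeff]
  obtain ⟨c, hc⟩ := dvd_coeff_prod_one_add_mul_X_sub p j
  rw [← hP] at hc
  rw [hc]
  push_cast
  simpa using (padicOrdGe_one_natCast p).mul (PadicOrdGe.of_int (p := p) c)

end CongP

end Literature.NumberTheory.Irrationality.LaiLupuSprang2025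

end
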